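import Summits.AtomisticToContinuum.Crystallization.Theorems.FrustratedLawDichotomyTextureIncoherence

/-!
# FrustratedLawDichotomy · crux `AperiodicFrustratedLawGap` (stmt-AtomisticToContinuum-27623) — TWO-WAY ε-MATCHINGS ARE INJECTIVE AND 2ε-ISOMETRIC (bookkeeping for (FLIP))
# (decomp-a2c hand-2 g45, STRUCTURAL share #60: DEF-FREE; critic r1710 (A) note to lens-5 g111 «hfwd's k and hbwd's p are unrestricted — use 7/10-separation
#  + δ-hard-core + small ε to make the matching injective where you need it»)

The texture clause `Appr` / `ApprM` matches the atoms `p` of `μ` near an atom `q` with the sites `y k` of a `7/10`-separated finite configuration near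
`y i` through `dist (y k − y i) (p − q) ≤ ε`, both ways, with NO injectivity stated.  (FLIP) must transfer neighbour shells across this matching.  With NO
new definitions:

* `abs_dist_sub_dist_le_of_matched` — matched pairs are `2ε`-isometric: `|dist (y k) (y k') − dist p p'| ≤ 2ε`;
* `eq_of_matched_of_separated` — if `y` is `s`-separated and `2ε < s`, a point is matched by AT MOST ONE site (`k = k'`);
* `eq_of_matched_of_isRootedHardCore` — if `μ` is rooted `δ`-hard-core and `2ε < δ`, a point is matched by AT MOST ONE atom (`p = p'`);
* `matched_injective_sites` / `matched_injective_atoms` — hence the forward matching (atoms ↦ sites) and the backward matching (sites ↦ atoms) are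
  injective on their domains, and `matched_inverse` — they are mutually inverse where both apply (`dist (y k − y i) (p − q) ≤ ε` twice forces the
  round trip to return to the same atom / site);
* `norm_sub_le_of_matched` / `le_norm_add_of_matched` — radii transfer: `‖y k − y i‖ ≤ ‖p − q‖ + ε` and conversely.

Tags: [folklore: metric bookkeeping].
-/

noncomputable section

namespace Summit.AtomisticToContinuum.Crystallization.Theorems.FrustratedLawDichotomyTextureMatching

open MeasureTheory Metric Set
open Literature.Probability.Process

variable {N : ℕ} {y : Fin N → EuclideanSpace ℝ (Fin 3)} {i : Fin N} {ε : ℝ}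

/-- **Matched pairs are `2ε`-isometric.** [folklore] -/
theorem abs_dist_sub_dist_le_of_matched {k k' : Fin N} {p p' q : EuclideanSpace ℝ (Fin 3)}
    (h1 : dist (y k - y i) (p - q) ≤ ε) (h2 : dist (y k' - y i) (p' - q) ≤ ε) :
    |dist (y k) (y k') - dist p p'| ≤ 2 * ε := by
  have e1 : dist (y k) (y k') = dist (y k - y i) (y k' - y i) := by rw [dist_sub_right]
  have e2 : dist p p' = dist (p - q) (p' - q) := by rw [dist_sub_right]
  rw [e1, e2]
  have t1 : |dist (y k - y i) (y k' - y i) - dist (p - q) (y k' - y i)| ≤ dist (y k - y i) (p - q) := abs_dist_sub_le _ _ _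
  have t2 : |dist (p - q) (y k' - y i) - dist (p - q) (p' - q)| ≤ dist (y k' - y i) (p' - q) := by
    rw [dist_comm (p - q) (y k' - y i), dist_comm (p - q) (p' - q)]
    exact abs_dist_sub_le _ _ _
  have := abs_sub_le (dist (y k - y i) (y k' - y i)) (dist (p - q) (y k' - y i)) (dist (p - q) (p' - q))
  linarith

/-- **Radii transfer, forward**: a matched site is at most `ε` farther from the centre than its atom is from `q`. [folklore] -/
theorem norm_sub_le_of_matched {k : Fin N} {p q : EuclideanSpace ℝ (Fin 3)} (h : dist (y k - y i) (p - q) ≤ ε) :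
    ‖y k - y i‖ ≤ ‖p - q‖ + ε := by
  have h1 := norm_le_norm_add_norm_sub' (y k - y i) (p - q)
  have h2 : ‖y k - y i - (p - q)‖ = dist (y k - y i) (p - q) := (dist_eq_norm _ _).symm
  linarith

/-- **Radii transfer, backward**: a matched atom is at most `ε` farther from `q` than its site is from the centre. [folklore] -/
theorem le_norm_add_of_matched {k : Fin N} {p q : EuclideanSpace ℝ (Fin 3)} (h : dist (y k - y i) (p - q) ≤ ε) :
    ‖p - q‖ ≤ ‖y k - y i‖ + ε := by
  have h1 := norm_le_norm_add_norm_sub' (p - q) (y k - y i)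
  have h2 : ‖p - q - (y k - y i)‖ = dist (y k - y i) (p - q) := by rw [← dist_eq_norm, dist_comm]
  linarith

/-- **One site per point**: if `y` is `s`-separated and `2ε < s`, two sites matched to the same point coincide. [folklore] -/
theorem eq_of_matched_of_separated {s : ℝ} (hsep : ∀ a b : Fin N, a ≠ b → s ≤ dist (y a) (y b)) (hε : 2 * ε < s)
    {k k' : Fin N} {v : EuclideanSpace ℝ (Fin 3)} (h1 : dist (y k - y i) v ≤ ε) (h2 : dist (y k' - y i) v ≤ ε) : k = k' := by
  by_contra hne
  have hfar := hsep k k' hne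
  have hnear : dist (y k) (y k') ≤ 2 * ε := by
    have e1 : dist (y k) (y k') = dist (y k - y i) (y k' - y i) := by rw [dist_sub_right]
    rw [e1]
    calc dist (y k - y i) (y k' - y i) ≤ dist (y k - y i) v + dist (y k' - y i) v := dist_triangle_right _ _ _
      _ ≤ 2 * ε := by linarith
  linarith

/-- **One atom per point**: if `μ` is rooted `δ`-hard-core and `2ε < δ`, two atoms matched to the same point coincide. [folklore] -/
theorem eq_of_matched_of_isRootedHardCore {δ : ℝ} {μ : Measure (EuclideanSpace ℝ (Fin 3))} (hμ : IsRootedHardCore δ μ) (hε : 2 * ε < δ)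
    {p p' v q : EuclideanSpace ℝ (Fin 3)} (hp : μ {p} ≠ 0) (hp' : μ {p'} ≠ 0) (h1 : dist v (p - q) ≤ ε) (h2 : dist v (p' - q) ≤ ε) :
    p = p' := by
  obtain ⟨S, -, hsep, rfl⟩ := hμ
  have hpS : p ∈ S := (count_restrict_singleton_ne_zero_iff S p).mp hp
  have hp'S : p' ∈ S := (count_restrict_singleton_ne_zero_iff S p').mp hp'
  by_contra hne
  have hfar := hsep p hpS p' hp'S hne
  have hnear : dist p p' ≤ 2 * ε := by
    have e1 : dist p p' = dist (p - q) (p' - q) := by rw [dist_sub_right]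
    rw [e1]
    calc dist (p - q) (p' - q) ≤ dist v (p - q) + dist v (p' - q) := by
          rw [dist_comm v (p - q)]; exact dist_triangle _ _ _
      _ ≤ 2 * ε := by linarith
  linarith

/-- **The forward matching is injective**: two atoms matched to the same site coincide (`μ` rooted `δ`-hard-core, `2ε < δ`). [folklore] -/
theorem matched_injective_atoms {δ : ℝ} {μ : Measure (EuclideanSpace ℝ (Fin 3))} (hμ : IsRootedHardCore δ μ) (hε : 2 * ε < δ)
    {k : Fin N} {p p' q : EuclideanSpace ℝ (Fin 3)} (hp : μ {p} ≠ 0) (hp' : μ {p'} ≠ 0)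
    (h1 : dist (y k - y i) (p - q) ≤ ε) (h2 : dist (y k - y i) (p' - q) ≤ ε) : p = p' :=
  eq_of_matched_of_isRootedHardCore hμ hε hp hp' h1 h2

/-- **The backward matching is injective**: two sites matched to the same atom coincide (`y` `s`-separated, `2ε < s`). [folklore] -/
theorem matched_injective_sites {s : ℝ} (hsep : ∀ a b : Fin N, a ≠ b → s ≤ dist (y a) (y b)) (hε : 2 * ε < s)
    {k k' : Fin N} {p q : EuclideanSpace ℝ (Fin 3)} (h1 : dist (y k - y i) (p - q) ≤ ε) (h2 : dist (y k' - y i) (p - q) ≤ ε) : k = k' :=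
  eq_of_matched_of_separated hsep hε h1 h2

/-- **Round trips close up**: if the atom `p` is matched to the site `k`, the site `k` is matched back to the atom `p'`, and `2ε < δ`, then `p' = p`
(and symmetrically for sites, by `matched_injective_sites`). [folklore] -/
theorem matched_inverse {δ : ℝ} {μ : Measure (EuclideanSpace ℝ (Fin 3))} (hμ : IsRootedHardCore δ μ) (hε : 2 * ε < δ)
    {k : Fin N} {p p' q : EuclideanSpace ℝ (Fin 3)} (hp : μ {p} ≠ 0) (hp' : μ {p'} ≠ 0)
    (hfwd : dist (y k - y i) (p - q) ≤ ε) (hbwd : dist (y k - y i) (p' - q) ≤ ε) : p' = p :=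
  (matched_injective_atoms hμ hε hp hp' hfwd hbwd).symm

end Summit.AtomisticToContinuum.Crystallization.Theorems.FrustratedLawDichotomyTextureMatching

end
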